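import Summits.HodgeConjecture.HodgeConjecture.Theses.FirstOrderSemiregularSeeds
import Summits.HodgeConjecture.HodgeConjecture.Theorems.FirstOrderSemiregularSeedsFirstOrderWeilSeedsEightCPad4Anchor
import Literature.AlgebraicGeometry.KTheory.ChernCharacterPresentsAlgebraicClasses
import Literature.AlgebraicGeometry.HodgeTheory.WeilClassesFourfoldsProofs
import Literature.AlgebraicGeometry.Motives.AbelianVarietyProductDimProofs
import Literature.NumberTheory.EllipticCurves.CMEndomorphismOfMulMemLattice
import Literature.AlgebraicGeometry.HodgeTheory.HyperbolicWeilTypeExistence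
import HarnessLib
import HarnessLib.Audit

/-!
# Line `birthP` (BC3 / BC5 PLAN-ONLY skeleton, v3) — crux `FirstOrderSemiregularSeeds.FirstOrderWeilSeedsEightCP` (X2″)
# (item stmt-HodgeConjecture-24700, route route-HodgeConjecture-FirstOrderSemiregularSeeds rev 5/6, f7400de1c979 / a76479c972ec)
# tribunal-w planner `hodge-fos-w-1` g3, 2026-08-28 (director R12.7 (3)(ii): the K-theoretic input DISPLAYED at route level).
# Predecessors: `Lines/birthC.lean` v1 (g0, J r1 F1/F2) and v2 (g2, J r2 F3) for the ASIDE X2′ = `FirstOrderWeilSeedsEightC`.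

HONEST FRAMING. Nothing in this file proves X2″, X2′, X1, rung H2 (`SevenfoldWeilCensus.WeilSixfolds`), HC for abelian
varieties or the Hodge conjecture. THREE statements are SORRIED STUBS (`stub_lfDesign_pad4` — optional, not load-bearing;
`stub_firstOrderLift_pad4` ⟹ `stub_firstOrderLift_pad4_at` — the rung, load-bearing); everything else is proved here or in the tree.

Crux (VERBATIM the route decl, concluded BY NAME below): `FirstOrderWeilSeedsEightCP` —
`Literature.AlgebraicGeometry.KTheory.Fulton1998_chernCharacter_presentsAlgebraicClasses →` for EVERY Chern-character theory
`C : ChernCharacterBetti` and every `d > 0`, `HasHyperbolicSeedOn 𝒪_C 4 d`: some complex abelian EIGHTFOLD `P` with `ψ₀ ≫ ψ₀ = -d`,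
HYPERBOLIC for a `K`-symmetrised hyperplane class `h_K = d·e^*a + ψ₀^*e^*a`, a non-zero rational class `w` of its `ℚ(√-d)`-Weil
space, and an `𝒪_C`-SEED for `q·h_K⁴ + w`: a finite locally free `E₀` on `P.X` with `ch_p(E₀) = κ_p` (`κ₄ = q·h⁴ + w`,
`κ_p = c_p·hᵖ` otherwise, `p ≤ 8`) that LIFTS TO FIRST ORDER (over every square-zero Artinian point of the base centred at the
fibre) along every smooth projective family through `P.X` on which all `ch_p(E₀)` stay of Hodge type.  `𝒪_C` is the route's
inlined object class, NAMED here `foClass C` (same lambda; `firstOrderWeilSeedsEightCP_iff` is `Iff.rfl`).  The antecedent is the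
refereed NAMED FACT displayed in the route binder `ChernCharacterPresenting` (K-CK, stmt-HodgeConjecture-24699): Fulton,
Intersection Theory, Ex. 15.2.16 (b) p. 283 («ch : K(X)_ℚ ⥲ A(X)_ℚ», X non-singular) + Cor. 19.2 (b) p. 365, with Serre's theorem
(Hartshorne II.5.17 p. 153) absorbing the negative part of a virtual bundle into `𝒪(m)^r` — landed p593570, render-checked by this
seat (locators verified on the materialised pages; content print-faithful for the genuine `ch`; caveat: `∀ C` over the axiom
structure is the tree idiom, print knows the genuine `ch` only).

## What changed against v2 (`birthC.lean`)
* THE CLASS HALF IS PROVED modulo the displayed fact: `lfDesign_pad4_of_presents : Fact → ‹stub_lfDesign_pad4›` (§2) — `w` is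
  ALGEBRAIC at the CM anchor (`Theorems.pad4Anchor_hodgeClass_mem_algebraicClasses`, Tate–Murasaki; hodge-fos-kappa-p1 p592611),
  `h_K = μ⁻¹·e'^*a'` for another projective embedding (`Theorems.exists_projectiveEmbedding_symmetrised`, same file), and the fact
  applied on the smooth projective anchor (`AbelianVariety.isSmoothProjective_holds`) to `κ = (0,…,0,w,0,…,0)` returns an HONEST
  bundle `E` with `C.ch_p(E) = N·κ_p + c_p·(e'^*a')ᵖ = N·κ_p + (c_p μᵖ)·h_Kᵖ` (`cupPowTwo_smul`): the κ-shape for `w' = N·w`, `q = c₄μ⁴`.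
* The geometric datum `(e, a hyperbolic, w ≠ 0 rational (4,4) Weil)` is now IN THE TREE (`Theorems.pad4Anchor_hyperbolic_weilClass`,
  discharged at `Ψ = pad4Action E₀ ψ₀` by `rfl`); v2 proved it in-file (§1b) — `pad4_geometricDatum` below is the one-line citation.
* `stub_kappaDesign_pad4` (K) is gone as a stub: `kappaDesign_pad4_of_presents : Fact → ‹K›` is proved.  Registered stubs: D
  (optional), R (uniform rung), R_at (pinned rung, LOAD-BEARING).  Composition: `FirstOrderWeilSeedsEightCP_of := fun hF ↦
  R_at ∘ (class half from hF)` — the crux BY NAME; sorries only inside `stub_*`.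

## Why-clause (tribunal T3 / BC5 — PLAN-ONLY; flag `T3-plan-only` expected, unchanged from v2)
RUNG DESIGNATE = `stub_firstOrderLift_pad4_at` — «if the anchor `S_d⁴(E₀)` carries SOME hyperbolic datum `(e, a, w)` with an
f.l.f. κ-design (now a THEOREM modulo the displayed fact, for every `C` and `d`), it carries SOME such datum with a
FIRST-ORDER-LIFTABLE f.l.f. κ-design».  ONE certified 16/16 design with its own typed `(e, a, w)` proves it outright.  WHY IT IS A
WITNESS OF THE LEVER AND NOT OF S: (i) it lives on EIGHTFOLDS (n = 4), where the amplification chain's output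
(`WeilAlgebraicSplitHyperplane 4 d` ⇒ every `√-d` sixfold) is open — in print Weil classes are algebraic on fourfolds (Markman
2025, all d) and on special CM/product members only; (ii) its content is DEFORMATION-THEORETIC — `θ(ξ)·At(E₀) = 0 ∈ Ext²(E₀,E₀)`
for the 16 Weil rows `ξ ∈ T_W` at the anchor — which HC AT THE ANCHOR (on `E₀⁸`, E₀ CM, every `(p,p)` class is a polynomial in
divisors; this is exactly what the class half USES) does NOT give: algebraicity of `w` at one CM point says nothing about a bundle
carrying `N·w` that survives to first order towards the generic hyperbolic point, where HC is open; (iii) it exercises exactly the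
route's lever (admissibility = first-order liftability instead of σ-injectivity).  NAMED TECHNIQUE: the Atiyah-class row test
`θ(ξ) = ξ ∪ At(E₀)` on the 16 rows (instrument seat `hodge-fos-x2-inst-1`, kit j292340 dictionary; §Reductions R1–R3 of
`birthC.lean`: the design must contain an indecomposable summand with NON-SCALAR Atiyah class that is not a box product — in
particular NOT the bundle the class half produces by direct sums and Serre twists, whose first-order behaviour is unknown), then
`LiftsAlong` over square-zero Artinian points.  Instrument status (j292340): genus-4 Jacobian End-secant designs 9/1/6 (Schottky
row fails), `E⁴` coordinate designs ≤ 6/16; untested: complete-intersection designs (a₃,d) = (1,5), (0,12), theta designs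
(arXiv:2502.03415 Ex. 8.2.5).

## Registered stubs (sorried; a prover closes one with `propose --supports stmt-HodgeConjecture-24700` BY NAME + SIGNATURE)
* `stub_lfDesign_pad4` (D; v2 text byte-for-byte) — OPTIONAL, NOT load-bearing in v3: the axioms-only class half (no named fact;
  recipe: v2 §Class-half plan / memo `STUB-PLAN-stub_kappaDesign_pad4.md` — SPAN ⇒ Vandermonde purification by `[m]^*` ⇒ Serre A
  sub-bundle quotient).  Proved here MODULO the fact (`lfDesign_pad4_of_presents`).  Size M–L (tree API).  Why it might fail: only
  through missing API (Serre A, sub-bundle quotients, `[m]^*` on `H^(2p)`), not mathematically.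
* `stub_firstOrderLift_pad4` (R; v1/v2 text) — the UNIFORM rung: every datum with an f.l.f. κ-design upgrades to a first-order
  liftable one.  Size XL.  Implies R_at (`firstOrderLift_pad4_at_of_uniform`).
* `stub_firstOrderLift_pad4_at` (R_at; v2 text) — **THE RUNG DESIGNATE and the ONLY load-bearing stub**.  Size XL.  WHY IT MIGHT
  FAIL: the 16 linear conditions `θ(ξ)·At(E₀) = 0` may be unsatisfiable by any f.l.f. design with Weil-bearing `ch₄` on `E₀⁸` (an
  Atiyah-class obstruction theorem for Weil classes would refute X2″ for the genuine `ch` — KILL CRITERIA of the route).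
  Sources: Markman2025SurveySecant Q 11.4, Lemma 11.3, §12; BuchweitzFlenner2003 §4; FantechiManetti1999T1Lifting; arXiv:2502.03415
  Ex. 8.2.3–8.2.5; kit j292340.

## Disproof / negatives used
No `Disproof.lean` exists for X2′/X2″.  `ledger negatives --problem HodgeConjecture`: none concerns semiregularity, first-order
lifting or Weil type.  Dead sub-lines honoured as in v2 (object-level Q 11.4 counterexample not an abelian fibre; Jacobian /
coordinate designs not named as the rung object; ⊕ of line bundles excluded for the RUNG by R1+R2, allowed for the class half).

## References
[cite: Fulton1998, Ex. 15.2.16 (b) p. 283, §15.1 pp. 280–283, Cor. 19.2 (b) p. 365] [cite: Hartshorne1977, II Thm. 5.17 p. 153]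
[cite: Markman2025SurveySecant, Q 11.4, Lemma 11.3, §11.4–§12] [cite: Markman2025SecantWeil, §1.5, §9]
[cite: BuchweitzFlenner2003, §4–§5] [cite: FantechiManetti1999T1Lifting, Thm. A] [cite: BlochEsnaultKerz2014CharZero, Thm. 2, Q 5]
[cite: vanGeemen1994HodgeAV, 5.2–5.4] [cite: Schoen1988HodgeWeil] [cite: arXiv:2502.03415, Ex. 8.2.3–8.2.5]
[cite: HuybrechtsLehn1997, 2.A and Thm. 4.5.3] [cite: Mukai1978Semihomogeneous, §5–§6]
-/

noncomputable section

-- single-problem summit (Problem = Summit): the mandated namespace repeats `HodgeConjecture`.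
set_option linter.dupNamespace false

open CategoryTheory AlgebraicGeometry
open Literature.AlgebraicGeometry Literature.AlgebraicGeometry.Motives Literature.AlgebraicGeometry.HodgeTheory
open Literature.AlgebraicTopology.SingularHomology
open Summit.Ventures.HSemireg

namespace Summit.HodgeConjecture.HodgeConjecture.Cruxes.FirstOrderWeilSeedsEightCP.Birth

universe u

/-! ## §0 The object classes: `𝒪_C` named, and its class half -/

/-- **`𝒪_C` NAMED** — VERBATIM the object class inlined in the route decls `FirstOrderSemiregularTransfer` /
`FirstOrderWeilSeedsEightCP` (finite locally free `E₀` on an abelian fibre, all Chern-character degrees `I = {0,…,n}`,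
lifting to first order over every square-zero Artinian point of the base along every smooth projective family through `X₀`
on which `ch(E₀)` stays of Hodge type).  `firstOrderWeilSeedsEightCP_iff` checks the copy by `Iff.rfl`.
[cite: Markman2025SurveySecant, Q 11.4 (first-order reading)] [cite: FantechiManetti1999T1Lifting, §1] -/
def foClass (C : ChernCharacterBetti) : ObjClass :=
  fun (n : ℕ) (X₀ : Literature.AlgebraicGeometry.Motives.SchemeOver ℂ) (I : Finset ℕ) (κ : (p : ℕ) → Literature.AlgebraicGeometry.HodgeTheory.complexBetti X₀ (2 * p)) => I = Finset.range (n + 1) ∧ (∃ P₀ : Literature.AlgebraicGeometry.Motives.AbelianVariety ℂ, Nonempty (X₀ ≅ P₀.X)) ∧ ∃ (E₀ : X₀.left.Modules) (_ : Literature.AlgebraicGeometry.Motives.IsFiniteLocallyFree E₀), (∀ p ∈ I, κ p = C.ch X₀ E₀ p) ∧ ∀ ⦃𝒳 S : Literature.AlgebraicGeometry.Motives.SchemeOver ℂ⦄ (π : 𝒳 ⟶ S), Literature.AlgebraicGeometry.Motives.IsSmoothProjectiveFamily π n → AlgebraicGeometry.Smooth S.hom → ∀ ⦃U : Set (Literature.AlgebraicGeometry.Motives.ComplexPoints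 S)⦄ (hU : Literature.AlgebraicGeometry.HodgeTheory.IsCohomologicallyLocallyTrivialOn π U) (s₀ : U) (e : X₀ ≅ Literature.AlgebraicGeometry.Motives.fiberOver π s₀.1), (∀ p ∈ Finset.range (n + 1), ∀ (t : U) (γ : Path.Homotopic.Quotient s₀ t), Literature.AlgebraicGeometry.HodgeTheory.IsOfHodgeType n (Literature.AlgebraicGeometry.Motives.fiberOver π t.1) (2 * p) p p (Literature.AlgebraicGeometry.HodgeTheory.transportFun π (2 * p) hU γ (Literature.AlgebraicGeometry.HodgeTheory.complexBetti.map e.inv (2 * p) (C.ch X₀ E₀ p)))) → ∀ (A B : Type) [CommRing A] [Algebra ℂ A] [IsArtinianRing A] [IsLocalRing A] [CommRing B] [Algebra ℂ B] (f : A →ₐ[ℂ] B), Function.Surjective f → IsLocalRing.maximalIdeal A * IsLocalRing.maximalIdeal A = ⊥ → ∀ (ρ : B →ₐ[ℂ] ℂ) (a : Literature.AlgebraicGeometry.Motives.specOver ℂ A ⟶ S), CategoryTheory.CategoryStruct.comp (AlgebraicGeometry.Spec.map (CommRingCat.ofHom (ρ.comp f).toRingHom)) a.left = s₀.1.left → ∀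 ⦃XA XB : AlgebraicGeometry.Scheme⦄ (gA : XA ⟶ 𝒳.left) (qA : XA ⟶ AlgebraicGeometry.Spec (CommRingCat.of A)), CategoryTheory.IsPullback gA qA π.left a.left → ∀ (i : XB ⟶ XA) (qB : XB ⟶ AlgebraicGeometry.Spec (CommRingCat.of B)), CategoryTheory.IsPullback i qB qA (AlgebraicGeometry.Spec.map (CommRingCat.ofHom f.toRingHom)) → ∀ (j : X₀.left ⟶ XB), CategoryTheory.IsPullback j X₀.hom qB (AlgebraicGeometry.Spec.map (CommRingCat.ofHom ρ.toRingHom)) → CategoryTheory.CategoryStruct.comp j (CategoryTheory.CategoryStruct.comp i gA) = CategoryTheory.CategoryStruct.comp e.hom.left (Literature.AlgebraicGeometry.Motives.fiberι π s₀.1).left → ∀ (F : XB.Modules), Literature.AlgebraicGeometry.Motives.IsVectorBundle F → Nonempty ((AlgebraicGeometry.Scheme.Modules.pullback j).obj F ≅ E₀) → Literature.AlgebraicGeometry.Deformation.LiftsAlong i F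

/-- **The CLASS HALF of `𝒪_C`** — the same with the first-order clause DELETED: finite locally free κ-designs on abelian
fibres (`κ_p = ch_p(E₀)` for `p ∈ I = {0,…,n}`).  Sub-rung vocabulary; NOT admissible for any transfer theorem by itself.
[cite: BuchweitzFlenner2003, §5 (sheaf data shape)] -/
def lfDesignClass (C : ChernCharacterBetti) : ObjClass :=
  fun (n : ℕ) (X₀ : Literature.AlgebraicGeometry.Motives.SchemeOver ℂ) (I : Finset ℕ) (κ : (p : ℕ) → Literature.AlgebraicGeometry.HodgeTheory.complexBetti X₀ (2 * p)) => I = Finset.range (n + 1) ∧ (∃ P₀ : Literature.AlgebraicGeometry.Motives.AbelianVariety ℂ, Nonempty (X₀ ≅ P₀.X)) ∧ ∃ (E₀ : X₀.left.Modules) (_ : Literature.AlgebraicGeometry.Motives.IsFiniteLocallyFree E₀), (∀ p ∈ I, κ p = C.ch X₀ E₀ p)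

/-- The route crux X2″ IS `Fact → ∀ C d, 0 < d → HasHyperbolicSeedOn (foClass C) 4 d` — definitionally (the lambda was
copied verbatim from the rev-5 route decl `FirstOrderSemiregularSeeds.FirstOrderWeilSeedsEightCP`). -/
theorem firstOrderWeilSeedsEightCP_iff :
    Summit.HodgeConjecture.HodgeConjecture.Theses.FirstOrderSemiregularSeeds.FirstOrderWeilSeedsEightCP ↔
      (Literature.AlgebraicGeometry.KTheory.Fulton1998_chernCharacter_presentsAlgebraicClasses →
        ∀ C : ChernCharacterBetti, ∀ d : ℕ, 0 < d → HasHyperbolicSeedOn (foClass C) 4 d) :=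
  Iff.rfl

/-- An `𝒪_C`-admissible `κ` is an f.l.f. κ-design (drop the first-order clause). -/
theorem lfDesignClass_of_foClass (C : ChernCharacterBetti) :
    ∀ n X₀ I κ, foClass C n X₀ I κ → lfDesignClass C n X₀ I κ := by
  rintro n X₀ I κ ⟨hI, hP, E₀, hE₀, hch, -⟩
  exact ⟨hI, hP, E₀, hE₀, hch⟩

/-! ## §1 The named anchor `S_d⁴`, `S_d = E₀ × E₀`, `φ = ψ₀ × (−ψ₀)`, `ψ₀ ≫ ψ₀ = -d` -/

section Anchor

variable (E₀ : AbelianVariety ℂ) (ψ₀ : E₀ ⟶ E₀)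

/-- The Weil surface `S = E₀ × E₀`. -/
abbrev weilSurf : AbelianVariety ℂ := E₀.prod E₀

/-- Its Weil action `φ_S = ψ₀ × (−ψ₀)` (the tree's `exists_weilType_cmSquare` shape). -/
abbrev weilSurfAct : weilSurf E₀ ⟶ weilSurf E₀ :=
  AbelianVariety.prodLift (AbelianVariety.fst E₀ E₀ ≫ ψ₀) (AbelianVariety.snd E₀ E₀ ≫ (-ψ₀))

/-- `S² = S × S`. -/
abbrev pad2Anchor : AbelianVariety ℂ := (weilSurf E₀).prod (weilSurf E₀)
/-- `S³ = S² × S`. -/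
abbrev pad3Anchor : AbelianVariety ℂ := (pad2Anchor E₀).prod (weilSurf E₀)
/-- **The PAD-4 anchor** `S⁴ = S³ × S` (as a complex torus `≅ E₀⁸`; Weil structure `(√-d, −√-d)⁴`, signature `(4,4)`). -/
abbrev pad4Anchor : AbelianVariety ℂ := (pad3Anchor E₀).prod (weilSurf E₀)

/-- Product action on `S²`. -/
abbrev pad2Action : pad2Anchor E₀ ⟶ pad2Anchor E₀ :=
  AbelianVariety.prodLift (AbelianVariety.fst _ _ ≫ weilSurfAct E₀ ψ₀) (AbelianVariety.snd _ _ ≫ weilSurfAct E₀ ψ₀)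
/-- Product action on `S³`. -/
abbrev pad3Action : pad3Anchor E₀ ⟶ pad3Anchor E₀ :=
  AbelianVariety.prodLift (AbelianVariety.fst _ _ ≫ pad2Action E₀ ψ₀) (AbelianVariety.snd _ _ ≫ weilSurfAct E₀ ψ₀)
/-- **The PAD-4 action** `ψ = φ_S × φ_S × φ_S × φ_S` on `S⁴`. -/
abbrev pad4Action : pad4Anchor E₀ ⟶ pad4Anchor E₀ :=
  AbelianVariety.prodLift (AbelianVariety.fst _ _ ≫ pad3Action E₀ ψ₀) (AbelianVariety.snd _ _ ≫ weilSurfAct E₀ ψ₀)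

/-- The `K`-symmetrised hyperplane class `h_K(d, e, a) = d·ι^*a + ψ^*ι^*a` (the literal shape inside `HasHyperbolicSeedOn 𝒪 4 d`). -/
abbrev symH (d : ℕ) {P : AbelianVariety ℂ} (ψ : P ⟶ P) (e : ProjectiveEmbedding P.X)
    (a : complexBetti (projectiveSpace e.n ℂ) 2) : complexBetti P.X 2 :=
  (d : ℂ) • complexBetti.map e.ι 2 a + complexBetti.map ψ.hom.hom.hom 2 (complexBetti.map e.ι 2 a)

variable {E₀ ψ₀}

/-- `dim S = 2·1`. -/
theorem weilSurf_dim (hE : E₀.dim = 1) : (weilSurf E₀).dim = 2 * 1 := by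
  show (E₀.prod E₀).dim = 2 * 1
  rw [AbelianVariety.dim_prod, hE]

/-- `dim S⁴ = 2·4`. -/
theorem pad4Anchor_dim (hE : E₀.dim = 1) : (pad4Anchor E₀).dim = 2 * 4 := by
  have h1 := weilSurf_dim hE
  have h2 : (pad2Anchor E₀).dim = 2 * (1 + 1) := dim_prod_eq_two_mul h1 h1
  have h3 : (pad3Anchor E₀).dim = 2 * ((1 + 1) + 1) := dim_prod_eq_two_mul h2 h1
  have h4 : (pad4Anchor E₀).dim = 2 * (((1 + 1) + 1) + 1) := dim_prod_eq_two_mul h3 h1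
  simpa using h4

/-- `(−ψ₀)² = ψ₀²`. -/
theorem neg_comp_neg_eq {d : ℕ} (hψ : ψ₀ ≫ ψ₀ = -(d • 𝟙 E₀)) : (-ψ₀) ≫ (-ψ₀) = -(d • 𝟙 E₀) := by
  rw [Preadditive.neg_comp_neg]; exact hψ

/-- `φ_S ≫ φ_S = -d`. -/
theorem weilSurfAct_comp_self {d : ℕ} (hψ : ψ₀ ≫ ψ₀ = -(d • 𝟙 E₀)) :
    weilSurfAct E₀ ψ₀ ≫ weilSurfAct E₀ ψ₀ = -(d • 𝟙 (weilSurf E₀)) :=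
  prodLift_comp_self_eq_neg_nsmul hψ (neg_comp_neg_eq hψ)

/-- **`ψ ≫ ψ = -d` on `S⁴`.** -/
theorem pad4Action_comp_self {d : ℕ} (hψ : ψ₀ ≫ ψ₀ = -(d • 𝟙 E₀)) :
    pad4Action E₀ ψ₀ ≫ pad4Action E₀ ψ₀ = -(d • 𝟙 (pad4Anchor E₀)) := by
  have hS := weilSurfAct_comp_self hψ
  have h2 : pad2Action E₀ ψ₀ ≫ pad2Action E₀ ψ₀ = -(d • 𝟙 (pad2Anchor E₀)) :=
    prodLift_comp_self_eq_neg_nsmul hS hS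
  have h3 : pad3Action E₀ ψ₀ ≫ pad3Action E₀ ψ₀ = -(d • 𝟙 (pad3Anchor E₀)) :=
    prodLift_comp_self_eq_neg_nsmul h2 hS
  exact prodLift_comp_self_eq_neg_nsmul h3 hS

/-- `dim S² = 2·2` (v2). -/
theorem pad2Anchor_dim (hE : E₀.dim = 1) : (pad2Anchor E₀).dim = 2 * 2 :=
  dim_prod_eq_two_mul (weilSurf_dim hE) (weilSurf_dim hE)

/-- `dim S³ = 2·3` (v2). -/
theorem pad3Anchor_dim (hE : E₀.dim = 1) : (pad3Anchor E₀).dim = 2 * 3 :=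
  dim_prod_eq_two_mul (pad2Anchor_dim hE) (weilSurf_dim hE)

/-- `φ ≫ φ = -d` on `S²` (v2). -/
theorem pad2Action_comp_self {d : ℕ} (hψ : ψ₀ ≫ ψ₀ = -(d • 𝟙 E₀)) :
    pad2Action E₀ ψ₀ ≫ pad2Action E₀ ψ₀ = -(d • 𝟙 (pad2Anchor E₀)) :=
  prodLift_comp_self_eq_neg_nsmul (weilSurfAct_comp_self hψ) (weilSurfAct_comp_self hψ)

/-- `φ ≫ φ = -d` on `S³` (v2). -/
theorem pad3Action_comp_self {d : ℕ} (hψ : ψ₀ ≫ ψ₀ = -(d • 𝟙 E₀)) :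
    pad3Action E₀ ψ₀ ≫ pad3Action E₀ ψ₀ = -(d • 𝟙 (pad3Anchor E₀)) :=
  prodLift_comp_self_eq_neg_nsmul (pad2Action_comp_self hψ) (weilSurfAct_comp_self hψ)

/-- **The geometric datum on `S_d⁴` — IN THE TREE** (hodge-fos-kappa-p1, p592611:
`Theorems.pad4Anchor_hyperbolic_weilClass`, discharged at `Ψ = pad4Action E₀ ψ₀` by `rfl`): a projective embedding `e`, a
rational `a ≠ 0` with `(pad4Anchor E₀, pad4Action E₀ ψ₀)` HYPERBOLIC for `h_K = symH d ψ e a`, and a non-zero rational `(4,4)`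
Weil class `w`. [cite: Markman2025SurveySecant, §11.5 Step 2] [cite: vanGeemen1994HodgeAV, 5.2–5.4] -/
theorem pad4_geometricDatum (hE : E₀.dim = 1) {d : ℕ} (hd : 0 < d) (hψ : ψ₀ ≫ ψ₀ = -(d • 𝟙 E₀)) :
    ∃ (e : ProjectiveEmbedding (pad4Anchor E₀).X) (a : complexBetti (projectiveSpace e.n ℂ) 2)
      (w : complexBetti (pad4Anchor E₀).X (2 * 4)),
      IsRationalClass a ∧ a ≠ 0 ∧
      IsHyperbolicWeilType (pad4Anchor E₀) (pad4Action E₀ ψ₀) 4 (symH d (pad4Action E₀ ψ₀) e a) ∧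
      w ∈ weilClassesOf (pad4Anchor E₀) (pad4Action E₀ ψ₀) 4 d ∧ IsRationalClass w ∧
      IsOfHodgeType (2 * 4) (pad4Anchor E₀).X (2 * 4) 4 4 w ∧ w ≠ 0 := by
  obtain ⟨-, -, ⟨e, a, ha, ha0, hhyp⟩, ⟨w, hwr, hwH, hwW, hw0⟩⟩ :=
    Summit.HodgeConjecture.HodgeConjecture.Theorems.pad4Anchor_hyperbolic_weilClass hE hd hψ (pad4Action E₀ ψ₀) rfl
  exact ⟨e, a, w, ha, ha0, hhyp, hwW, hwr, hwH, hw0⟩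

end Anchor

/-! ## §2 The CLASS HALF modulo the displayed K-theoretic fact (PROVED here; no sorry) -/

/-- **CLASS HALF, DESIGN-ONLY FORM, from the displayed fact `Fulton1998_chernCharacter_presentsAlgebraicClasses`**: for every
`C`, `d > 0`, CM datum and every hyperbolic datum `(e, a)` with a non-zero rational `(4,4)` Weil class `w` on the pinned anchor,
the class `w' := N • w` (some `N ≥ 1`) carries a FINITE LOCALLY FREE κ-design of the seed's shape for `h_K = symH d ψ e a`.
Proof: `w` is ALGEBRAIC at the CM anchor (`Theorems.pad4Anchor_hodgeClass_mem_algebraicClasses`, Tate–Murasaki); `h_K` is a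
non-zero rational multiple `μ⁻¹ • e'^*a'` of a hyperplane class (`Theorems.exists_projectiveEmbedding_symmetrised`); the fact,
applied on the smooth projective `S_d⁴` (`AbelianVariety.isSmoothProjective_holds`) to `κ = (0,…,0,w,0,…,0)`, gives an honest
bundle `E` with `C.ch_p(E) = N·κ_p + c_p·(e'^*a')ᵖ = N·κ_p + (c_p μᵖ)·h_Kᵖ` — the κ-shape with `q = c₄ μ⁴`.
[cite: Fulton1998, Example 15.2.16 (b) p. 283; §15.1] [cite: Hartshorne1977, II Thm. 5.17 p. 153] -/
theorem lfDesign_pad4_of_presents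
    (hF : Literature.AlgebraicGeometry.KTheory.Fulton1998_chernCharacter_presentsAlgebraicClasses) :
    ∀ (C : ChernCharacterBetti) (d : ℕ), 0 < d →
      ∀ (E₀ : AbelianVariety ℂ) (ψ₀ : E₀ ⟶ E₀), E₀.dim = 1 → ψ₀ ≫ ψ₀ = -(d • 𝟙 E₀) →
      ∀ (e : ProjectiveEmbedding (pad4Anchor E₀).X) (a : complexBetti (projectiveSpace e.n ℂ) 2)
      (w : complexBetti (pad4Anchor E₀).X (2 * 4)),
      IsRationalClass a → a ≠ 0 →
      IsHyperbolicWeilType (pad4Anchor E₀) (pad4Action E₀ ψ₀) 4 (symH d (pad4Action E₀ ψ₀) e a) →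
      w ∈ weilClassesOf (pad4Anchor E₀) (pad4Action E₀ ψ₀) 4 d → IsRationalClass w →
      IsOfHodgeType (2 * 4) (pad4Anchor E₀).X (2 * 4) 4 4 w → w ≠ 0 →
      ∃ w' : complexBetti (pad4Anchor E₀).X (2 * 4),
        w' ∈ weilClassesOf (pad4Anchor E₀) (pad4Action E₀ ψ₀) 4 d ∧ IsRationalClass w' ∧ w' ≠ 0 ∧
        HasSeedOn (lfDesignClass C) 4 (pad4Anchor E₀) (symH d (pad4Action E₀ ψ₀) e a) w' := by
  intro C d hd E₀ ψ₀ hE hψ e a w ha ha0 _hhyp hwW hwr hwH hw0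
  -- (1) the `K`-symmetrised class is a non-zero rational multiple of a hyperplane class
  obtain ⟨e', a', μ, ha', ha'0, hμ0, he'⟩ :=
    Summit.HodgeConjecture.HodgeConjecture.Theorems.exists_projectiveEmbedding_symmetrised hd
      (pad4Action_comp_self hψ) e ha ha0
  -- (2) the Weil class is ALGEBRAIC at the CM anchor (Tate–Murasaki)
  have hwalg : w ∈ algebraicClasses (pad4Anchor E₀).X 4 :=
    Summit.HodgeConjecture.HodgeConjecture.Theorems.pad4Anchor_hodgeClass_mem_algebraicClasses hE hwr hwH
  -- (3) the target classes: `w` in degree 4, `0` elsewhere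
  obtain ⟨κF, hκF⟩ : ∃ κF : (p : ℕ) → complexBetti (pad4Anchor E₀).X (2 * p),
      κF = Function.update (fun p => (0 : complexBetti (pad4Anchor E₀).X (2 * p))) 4 w := ⟨_, rfl⟩
  have hκ4 : κF 4 = w := by rw [hκF, Function.update_self]
  have hκne : ∀ p, p ≠ 4 → κF p = 0 := fun p hp => by rw [hκF, Function.update_of_ne hp]
  have hκrat : ∀ p, IsRationalClass (κF p) := by
    intro p
    by_cases hp : p = 4
    · subst hp; rw [hκ4]; exact hwr
    · rw [hκne p hp]; exact IsRationalClass.zero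
  have hκalg : ∀ p, κF p ∈ algebraicClasses (pad4Anchor E₀).X p := by
    intro p
    by_cases hp : p = 4
    · subst hp; rw [hκ4]; exact hwalg
    · rw [hκne p hp]; exact Submodule.zero_mem _
  -- (4) Fulton Ex. 15.2.16 (b) + Serre: an HONEST bundle presenting `N • κF` modulo powers of `e'^* a'`
  obtain ⟨E, hElf, N, c, hN, hch⟩ :=
    hF C (AbelianVariety.isSmoothProjective_holds (A := pad4Anchor E₀)) e' a' ha' ha'0 κF hκrat hκalg
  have hNC : (N : ℂ) ≠ 0 := by exact_mod_cast hN.ne'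
  -- (5) the seed for `w' = N • w`
  refine ⟨(N : ℂ) • w, Submodule.smul_mem _ _ hwW, ?_, smul_ne_zero hNC hw0, ?_⟩
  · have h := hwr.smul (N : ℚ)
    rwa [Rat.cast_natCast] at h
  · refine ⟨Finset.range (2 * 4 + 1), fun p => C.ch (pad4Anchor E₀).X E p, c 4 * μ ^ 4, fun p => c p * μ ^ p,
      Finset.mem_range.mpr (by norm_num), ⟨rfl, ⟨pad4Anchor E₀, ⟨Iso.refl _⟩⟩, E, hElf, fun p _ => rfl⟩, ?_, ?_⟩
    · have h4 := hch 4
      rw [hκ4, he', cupPowTwo_smul, smul_smul] at h4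
      beta_reduce
      rw [h4, add_comm, Rat.cast_mul, Rat.cast_pow]
    · intro p _ hp
      have h := hch p
      rw [hκne p hp, smul_zero, zero_add, he', cupPowTwo_smul, smul_smul] at h
      beta_reduce
      rw [h, Rat.cast_mul, Rat.cast_pow]


/-! ## §3 Registered stubs (theorem texts byte-for-byte the v2 ones) -/

/-- **STUB D (v2 text; v3 status: OPTIONAL, NOT load-bearing — PROVED modulo the displayed fact as `lfDesign_pad4_of_presents` above; closing it axioms-only would let a later route revision drop the Fulton display) — the DESIGN-ONLY residue of the class half**: for every `C`, `d > 0`, CM datum, and EVERY hyperbolic datum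
`(e, a)` with a non-zero rational `(4,4)` Weil class `w` on the pinned anchor (all supplied by `pad4_geometricDatum`), SOME non-zero
rational Weil class `w'` carries a finite locally free κ-design of the seed's shape for `h_K = symH d ψ e a`
(`ch_p ∈ ℚ h_Kᵖ` for `p ≠ 4`, `ch₄ = q h_K⁴ + w'`, all nine degrees).  PLAN (§Class-half plan above; memo
`STUB-PLAN-stub_kappaDesign_pad4.md`), using ONLY the `ChernCharacterBetti` axioms: `w` algebraic at the CM anchor ⇒ SPAN gives a
rational K-combination `x` of vector bundles with `C.ch₄(x) = w` ⇒ PURIFY to pure degree 4 by a Vandermonde combination of pull-backs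
`[m_j]^* x` (`map_ch`; `[m]^* = m^(2p)` on `H^(2p)`) ⇒ `N y = [E₊] − [E₋]` ⇒ replace `−[E₋]` by the f.l.f. quotient `Q = (L_h^m)^(⊕k)/E₋`
(Serre; `L_h = e^*𝒪(d) ⊗ ψ^*e^*𝒪(1)` a projective pull-back, so `C.ch₁(L_h) ∈ ℚ·h_K` by `map_ch` from `ℙ^K`) ⇒ `E₊ ⊕ Q` has
`C.ch = N N' w + k·exp(c·h_K)`, the κ-shape.  With `kappaDesign_pad4_of_lfDesign` (proved) it implies `stub_kappaDesign_pad4`.  WHY IT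
MIGHT FAIL: only through missing tree API (Serre's theorem A, sub-bundle quotients, `[m]^*` on `H^(2p)`, Segre/Veronese `H²`
formulas, algebraicity of the anchor's Weil classes as a citable theorem), not mathematically.  Size M–L.
[cite: Fulton1998, Ex. 3.2.3 and Ex. 15.2.16 (b)] [cite: Hartshorne1977, II.7 and III.5.2–5.3] [cite: vanGeemen1994HodgeAV, 5.2] -/
theorem stub_lfDesign_pad4 :
    ∀ (C : ChernCharacterBetti) (d : ℕ), 0 < d →
      ∀ (E₀ : AbelianVariety ℂ) (ψ₀ : E₀ ⟶ E₀), E₀.dim = 1 → ψ₀ ≫ ψ₀ = -(d • 𝟙 E₀) →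
      ∀ (e : ProjectiveEmbedding (pad4Anchor E₀).X) (a : complexBetti (projectiveSpace e.n ℂ) 2)
      (w : complexBetti (pad4Anchor E₀).X (2 * 4)),
      IsRationalClass a → a ≠ 0 →
      IsHyperbolicWeilType (pad4Anchor E₀) (pad4Action E₀ ψ₀) 4 (symH d (pad4Action E₀ ψ₀) e a) →
      w ∈ weilClassesOf (pad4Anchor E₀) (pad4Action E₀ ψ₀) 4 d → IsRationalClass w →
      IsOfHodgeType (2 * 4) (pad4Anchor E₀).X (2 * 4) 4 4 w → w ≠ 0 →
      ∃ w' : complexBetti (pad4Anchor E₀).X (2 * 4),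
        w' ∈ weilClassesOf (pad4Anchor E₀) (pad4Action E₀ ψ₀) 4 d ∧ IsRationalClass w' ∧ w' ≠ 0 ∧
        HasSeedOn (lfDesignClass C) 4 (pad4Anchor E₀) (symH d (pad4Action E₀ ψ₀) e a) w' := by
  sorry

/-- **STUB R (v1/v2 text; v3: the UNIFORM rung, implies the load-bearing `stub_firstOrderLift_pad4_at`) — THE RUNG (BC5 / T3 PLAN-ONLY) and THE BET: on the named anchor the class half UPGRADES to a FIRST-ORDER
LIFTABLE f.l.f. κ-design** (`HasSeedOn (foClass C) 4 (S_d⁴) h_K w` from `HasSeedOn (lfDesignClass C) 4 (S_d⁴) h_K w`).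
Technique: the Atiyah-class row test `θ(ξ) = ξ ∪ At(E₀) = 0 ∈ Ext²(E₀,E₀)` on the 16 Weil rows `T_W` (= the first-order
Hodge locus of `(h_K, w)` among polarised deformations at this anchor), certified per design by the instrument engine
(kit j292340 dictionary), then `LiftsAlong` over square-zero Artinian points (obstruction linear in the ideal).  Why it might
fail: module docstring.  J's designate `stub_firstOrderLift_EndSecant4` re-aimed (End-secant at Jacobian points: outcome (a)).
[cite: Markman2025SurveySecant, Q 11.4 and Lemma 11.3] [cite: BuchweitzFlenner2003, §4] [cite: FantechiManetti1999T1Lifting, Thm. A] -/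
theorem stub_firstOrderLift_pad4 :
    ∀ (C : ChernCharacterBetti) (d : ℕ), 0 < d →
      ∀ (E₀ : AbelianVariety ℂ) (ψ₀ : E₀ ⟶ E₀), E₀.dim = 1 → ψ₀ ≫ ψ₀ = -(d • 𝟙 E₀) →
      ∀ (e : ProjectiveEmbedding (pad4Anchor E₀).X) (a : complexBetti (projectiveSpace e.n ℂ) 2)
      (w : complexBetti (pad4Anchor E₀).X (2 * 4)),
      IsRationalClass a → a ≠ 0 →
      IsHyperbolicWeilType (pad4Anchor E₀) (pad4Action E₀ ψ₀) 4 (symH d (pad4Action E₀ ψ₀) e a) →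
      w ∈ weilClassesOf (pad4Anchor E₀) (pad4Action E₀ ψ₀) 4 d → IsRationalClass w → w ≠ 0 →
      HasSeedOn (lfDesignClass C) 4 (pad4Anchor E₀) (symH d (pad4Action E₀ ψ₀) e a) w →
      HasSeedOn (foClass C) 4 (pad4Anchor E₀) (symH d (pad4Action E₀ ψ₀) e a) w := by
  sorry

/-- **STUB R_at (v2 text, J r2 F3; v3: THE ONLY LOAD-BEARING STUB of X2″) — THE RUNG DESIGNATE, PINNED/EXISTENTIAL FORM**: on the named anchor, if SOME hyperbolic datum
`(e, a, w)` carries a finite locally free κ-design (the class half's conclusion, verbatim) then SOME such datum carries a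
FIRST-ORDER LIFTABLE one (the crux pinned to `S_d⁴(E₀)`).  Weaker than the uniform
`stub_firstOrderLift_pad4` (`firstOrderLift_pad4_at_of_uniform`), still strictly stronger than the crux at this anchor; decided
for a concrete design by the instrument's 16-row table, and by §Reductions the design must have an indecomposable summand with
non-scalar Atiyah class that is not a box product.  Technique and why it might fail: as for `stub_firstOrderLift_pad4`.
[cite: Markman2025SurveySecant, Q 11.4 and Lemma 11.3] [cite: BuchweitzFlenner2003, §4] [cite: FantechiManetti1999T1Lifting, Thm. A] -/
theorem stub_firstOrderLift_pad4_at :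
    ∀ (C : ChernCharacterBetti) (d : ℕ), 0 < d →
      ∀ (E₀ : AbelianVariety ℂ) (ψ₀ : E₀ ⟶ E₀), E₀.dim = 1 → ψ₀ ≫ ψ₀ = -(d • 𝟙 E₀) →
      (∃ (e : ProjectiveEmbedding (pad4Anchor E₀).X) (a : complexBetti (projectiveSpace e.n ℂ) 2)
        (w : complexBetti (pad4Anchor E₀).X (2 * 4)),
        IsRationalClass a ∧ a ≠ 0 ∧
        IsHyperbolicWeilType (pad4Anchor E₀) (pad4Action E₀ ψ₀) 4 (symH d (pad4Action E₀ ψ₀) e a) ∧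
        w ∈ weilClassesOf (pad4Anchor E₀) (pad4Action E₀ ψ₀) 4 d ∧ IsRationalClass w ∧ w ≠ 0 ∧
        HasSeedOn (lfDesignClass C) 4 (pad4Anchor E₀) (symH d (pad4Action E₀ ψ₀) e a) w) →
      (∃ (e : ProjectiveEmbedding (pad4Anchor E₀).X) (a : complexBetti (projectiveSpace e.n ℂ) 2)
        (w : complexBetti (pad4Anchor E₀).X (2 * 4)),
        IsRationalClass a ∧ a ≠ 0 ∧
        IsHyperbolicWeilType (pad4Anchor E₀) (pad4Action E₀ ψ₀) 4 (symH d (pad4Action E₀ ψ₀) e a) ∧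
        w ∈ weilClassesOf (pad4Anchor E₀) (pad4Action E₀ ψ₀) 4 d ∧ IsRationalClass w ∧ w ≠ 0 ∧
        HasSeedOn (foClass C) 4 (pad4Anchor E₀) (symH d (pad4Action E₀ ψ₀) e a) w) := by
  sorry

/-! ## §4 The composition (no sorry below) -/

/-- **the class half REDUCES to its design-only form** (v2; (`pad4_geometricDatum` supplies `(e, a, w)`). [folklore] -/
theorem kappaDesign_pad4_of_lfDesign
    (hD : ∀ (C : ChernCharacterBetti) (d : ℕ), 0 < d →
      ∀ (E₀ : AbelianVariety ℂ) (ψ₀ : E₀ ⟶ E₀), E₀.dim = 1 → ψ₀ ≫ ψ₀ = -(d • 𝟙 E₀) →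
      ∀ (e : ProjectiveEmbedding (pad4Anchor E₀).X) (a : complexBetti (projectiveSpace e.n ℂ) 2)
      (w : complexBetti (pad4Anchor E₀).X (2 * 4)),
      IsRationalClass a → a ≠ 0 →
      IsHyperbolicWeilType (pad4Anchor E₀) (pad4Action E₀ ψ₀) 4 (symH d (pad4Action E₀ ψ₀) e a) →
      w ∈ weilClassesOf (pad4Anchor E₀) (pad4Action E₀ ψ₀) 4 d → IsRationalClass w →
      IsOfHodgeType (2 * 4) (pad4Anchor E₀).X (2 * 4) 4 4 w → w ≠ 0 →
      ∃ w' : complexBetti (pad4Anchor E₀).X (2 * 4),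
        w' ∈ weilClassesOf (pad4Anchor E₀) (pad4Action E₀ ψ₀) 4 d ∧ IsRationalClass w' ∧ w' ≠ 0 ∧
        HasSeedOn (lfDesignClass C) 4 (pad4Anchor E₀) (symH d (pad4Action E₀ ψ₀) e a) w') :
    ∀ (C : ChernCharacterBetti) (d : ℕ), 0 < d →
      ∀ (E₀ : AbelianVariety ℂ) (ψ₀ : E₀ ⟶ E₀), E₀.dim = 1 → ψ₀ ≫ ψ₀ = -(d • 𝟙 E₀) →
      ∃ (e : ProjectiveEmbedding (pad4Anchor E₀).X) (a : complexBetti (projectiveSpace e.n ℂ) 2)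
      (w : complexBetti (pad4Anchor E₀).X (2 * 4)),
      IsRationalClass a ∧ a ≠ 0 ∧
      IsHyperbolicWeilType (pad4Anchor E₀) (pad4Action E₀ ψ₀) 4 (symH d (pad4Action E₀ ψ₀) e a) ∧
      w ∈ weilClassesOf (pad4Anchor E₀) (pad4Action E₀ ψ₀) 4 d ∧ IsRationalClass w ∧ w ≠ 0 ∧
      HasSeedOn (lfDesignClass C) 4 (pad4Anchor E₀) (symH d (pad4Action E₀ ψ₀) e a) w := by
  intro C d hd E₀ ψ₀ hE hψ
  obtain ⟨e, a, w, ha, ha0, hhyp, hwW, hwr, hwH, hw0⟩ := pad4_geometricDatum hE hd hψ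
  obtain ⟨w', hw'W, hw'r, hw'0, hseed⟩ := hD C d hd E₀ ψ₀ hE hψ e a w ha ha0 hhyp hwW hwr hwH hw0
  exact ⟨e, a, w', ha, ha0, hhyp, hw'W, hw'r, hw'0, hseed⟩


/-- **The v2 CLASS HALF `K` (datum + design), PROVED modulo the displayed fact.** [folklore composition] -/
theorem kappaDesign_pad4_of_presents
    (hF : Literature.AlgebraicGeometry.KTheory.Fulton1998_chernCharacter_presentsAlgebraicClasses) :
    ∀ (C : ChernCharacterBetti) (d : ℕ), 0 < d →
      ∀ (E₀ : AbelianVariety ℂ) (ψ₀ : E₀ ⟶ E₀), E₀.dim = 1 → ψ₀ ≫ ψ₀ = -(d • 𝟙 E₀) →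
      ∃ (e : ProjectiveEmbedding (pad4Anchor E₀).X) (a : complexBetti (projectiveSpace e.n ℂ) 2)
      (w : complexBetti (pad4Anchor E₀).X (2 * 4)),
      IsRationalClass a ∧ a ≠ 0 ∧
      IsHyperbolicWeilType (pad4Anchor E₀) (pad4Action E₀ ψ₀) 4 (symH d (pad4Action E₀ ψ₀) e a) ∧
      w ∈ weilClassesOf (pad4Anchor E₀) (pad4Action E₀ ψ₀) 4 d ∧ IsRationalClass w ∧ w ≠ 0 ∧
      HasSeedOn (lfDesignClass C) 4 (pad4Anchor E₀) (symH d (pad4Action E₀ ψ₀) e a) w :=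
  kappaDesign_pad4_of_lfDesign (lfDesign_pad4_of_presents hF)

/-- **the uniform rung implies the pinned one** (v2; so `Fact ∧ R ⟹ X2″` as `Fact ∧ R ⟹ K ∧ R_at ⟹ X2″`). [folklore] -/
theorem firstOrderLift_pad4_at_of_uniform
    (hR : ∀ (C : ChernCharacterBetti) (d : ℕ), 0 < d →
      ∀ (E₀ : AbelianVariety ℂ) (ψ₀ : E₀ ⟶ E₀), E₀.dim = 1 → ψ₀ ≫ ψ₀ = -(d • 𝟙 E₀) →
      ∀ (e : ProjectiveEmbedding (pad4Anchor E₀).X) (a : complexBetti (projectiveSpace e.n ℂ) 2)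
      (w : complexBetti (pad4Anchor E₀).X (2 * 4)),
      IsRationalClass a → a ≠ 0 →
      IsHyperbolicWeilType (pad4Anchor E₀) (pad4Action E₀ ψ₀) 4 (symH d (pad4Action E₀ ψ₀) e a) →
      w ∈ weilClassesOf (pad4Anchor E₀) (pad4Action E₀ ψ₀) 4 d → IsRationalClass w → w ≠ 0 →
      HasSeedOn (lfDesignClass C) 4 (pad4Anchor E₀) (symH d (pad4Action E₀ ψ₀) e a) w →
      HasSeedOn (foClass C) 4 (pad4Anchor E₀) (symH d (pad4Action E₀ ψ₀) e a) w) :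
    ∀ (C : ChernCharacterBetti) (d : ℕ), 0 < d →
      ∀ (E₀ : AbelianVariety ℂ) (ψ₀ : E₀ ⟶ E₀), E₀.dim = 1 → ψ₀ ≫ ψ₀ = -(d • 𝟙 E₀) →
      (∃ (e : ProjectiveEmbedding (pad4Anchor E₀).X) (a : complexBetti (projectiveSpace e.n ℂ) 2)
        (w : complexBetti (pad4Anchor E₀).X (2 * 4)),
        IsRationalClass a ∧ a ≠ 0 ∧
        IsHyperbolicWeilType (pad4Anchor E₀) (pad4Action E₀ ψ₀) 4 (symH d (pad4Action E₀ ψ₀) e a) ∧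
        w ∈ weilClassesOf (pad4Anchor E₀) (pad4Action E₀ ψ₀) 4 d ∧ IsRationalClass w ∧ w ≠ 0 ∧
        HasSeedOn (lfDesignClass C) 4 (pad4Anchor E₀) (symH d (pad4Action E₀ ψ₀) e a) w) →
      (∃ (e : ProjectiveEmbedding (pad4Anchor E₀).X) (a : complexBetti (projectiveSpace e.n ℂ) 2)
        (w : complexBetti (pad4Anchor E₀).X (2 * 4)),
        IsRationalClass a ∧ a ≠ 0 ∧
        IsHyperbolicWeilType (pad4Anchor E₀) (pad4Action E₀ ψ₀) 4 (symH d (pad4Action E₀ ψ₀) e a) ∧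
        w ∈ weilClassesOf (pad4Anchor E₀) (pad4Action E₀ ψ₀) 4 d ∧ IsRationalClass w ∧ w ≠ 0 ∧
        HasSeedOn (foClass C) 4 (pad4Anchor E₀) (symH d (pad4Action E₀ ψ₀) e a) w) := by
  intro C d hd E₀ ψ₀ hE hψ h
  obtain ⟨e, a, w, ha, ha0, hhyp, hwW, hwr, hw0, hseed⟩ := h
  exact ⟨e, a, w, ha, ha0, hhyp, hwW, hwr, hw0, hR C d hd E₀ ψ₀ hE hψ e a w ha ha0 hhyp hwW hwr hw0 hseed⟩

/-- **COMPOSITION, hypothesis-explicit form with the PINNED rung** (v2 text): a class half `hK` and `R_at` give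
`∀ C d, 0 < d → HasHyperbolicSeedOn (foClass C) 4 d`; both binders consumed (the CM curve from `exists_cmCurve_sqrt_neg d`,
`dim = 8` and `ψ² = -d` from §1). -/
theorem hasHyperbolicSeedOn_foClass_of_at
    (hK : ∀ (C : ChernCharacterBetti) (d : ℕ), 0 < d →
      ∀ (E₀ : AbelianVariety ℂ) (ψ₀ : E₀ ⟶ E₀), E₀.dim = 1 → ψ₀ ≫ ψ₀ = -(d • 𝟙 E₀) →
      ∃ (e : ProjectiveEmbedding (pad4Anchor E₀).X) (a : complexBetti (projectiveSpace e.n ℂ) 2)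
      (w : complexBetti (pad4Anchor E₀).X (2 * 4)),
      IsRationalClass a ∧ a ≠ 0 ∧
      IsHyperbolicWeilType (pad4Anchor E₀) (pad4Action E₀ ψ₀) 4 (symH d (pad4Action E₀ ψ₀) e a) ∧
      w ∈ weilClassesOf (pad4Anchor E₀) (pad4Action E₀ ψ₀) 4 d ∧ IsRationalClass w ∧ w ≠ 0 ∧
      HasSeedOn (lfDesignClass C) 4 (pad4Anchor E₀) (symH d (pad4Action E₀ ψ₀) e a) w)
    (hRat : ∀ (C : ChernCharacterBetti) (d : ℕ), 0 < d →
      ∀ (E₀ : AbelianVariety ℂ) (ψ₀ : E₀ ⟶ E₀), E₀.dim = 1 → ψ₀ ≫ ψ₀ = -(d • 𝟙 E₀) →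
      (∃ (e : ProjectiveEmbedding (pad4Anchor E₀).X) (a : complexBetti (projectiveSpace e.n ℂ) 2)
        (w : complexBetti (pad4Anchor E₀).X (2 * 4)),
        IsRationalClass a ∧ a ≠ 0 ∧
        IsHyperbolicWeilType (pad4Anchor E₀) (pad4Action E₀ ψ₀) 4 (symH d (pad4Action E₀ ψ₀) e a) ∧
        w ∈ weilClassesOf (pad4Anchor E₀) (pad4Action E₀ ψ₀) 4 d ∧ IsRationalClass w ∧ w ≠ 0 ∧
        HasSeedOn (lfDesignClass C) 4 (pad4Anchor E₀) (symH d (pad4Action E₀ ψ₀) e a) w) →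
      (∃ (e : ProjectiveEmbedding (pad4Anchor E₀).X) (a : complexBetti (projectiveSpace e.n ℂ) 2)
        (w : complexBetti (pad4Anchor E₀).X (2 * 4)),
        IsRationalClass a ∧ a ≠ 0 ∧
        IsHyperbolicWeilType (pad4Anchor E₀) (pad4Action E₀ ψ₀) 4 (symH d (pad4Action E₀ ψ₀) e a) ∧
        w ∈ weilClassesOf (pad4Anchor E₀) (pad4Action E₀ ψ₀) 4 d ∧ IsRationalClass w ∧ w ≠ 0 ∧
        HasSeedOn (foClass C) 4 (pad4Anchor E₀) (symH d (pad4Action E₀ ψ₀) e a) w)) :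
    ∀ (C : ChernCharacterBetti) (d : ℕ), 0 < d → HasHyperbolicSeedOn (foClass C) 4 d := by
  intro C d hd
  obtain ⟨E₀, ψ₀, hE, hψ⟩ :=
    Literature.NumberTheory.EllipticCurves.CMEndomorphism.exists_cmCurve_sqrt_neg d hd
  obtain ⟨e, a, w, ha, ha0, hhyp, hwW, hwr, hw0, hseed⟩ := hRat C d hd E₀ ψ₀ hE hψ (hK C d hd E₀ ψ₀ hE hψ)
  exact ⟨pad4Anchor E₀, pad4Action E₀ ψ₀, e, a, w, pad4Anchor_dim hE, pad4Action_comp_self hψ, ha, ha0, hhyp,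
    hwW, hwr, hw0, hseed⟩

/-- **THE SKELETON THEOREM (v3): the crux X2″, concluded BY NAME, from the displayed fact (its own antecedent), the PROVED class
half and the REGISTERED STUB `stub_firstOrderLift_pad4_at` (pinned rung)** — the only theorem of this file whose conclusion is the
crux constant; `closed = false` until the rung is proved (the uniform `stub_firstOrderLift_pad4` suffices in its place,
`firstOrderLift_pad4_at_of_uniform`; an axioms-only `stub_lfDesign_pad4` would make the antecedent idle). -/
theorem FirstOrderWeilSeedsEightCP_of :
    Summit.HodgeConjecture.HodgeConjecture.Theses.FirstOrderSemiregularSeeds.FirstOrderWeilSeedsEightCP :=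
  firstOrderWeilSeedsEightCP_iff.mpr fun hF =>
    hasHyperbolicSeedOn_foClass_of_at (kappaDesign_pad4_of_presents hF) stub_firstOrderLift_pad4_at

/-- Sanity (v3): the fact-free v2 content `K ∧ R_at` still gives the unfolded seed statement for every `C`, hence X2″ with an
idle antecedent — recorded on the UNFOLDED form so that only `FirstOrderWeilSeedsEightCP_of` concludes the crux constant. -/
example
    (hD : ∀ (C : ChernCharacterBetti) (d : ℕ), 0 < d →
      ∀ (E₀ : AbelianVariety ℂ) (ψ₀ : E₀ ⟶ E₀), E₀.dim = 1 → ψ₀ ≫ ψ₀ = -(d • 𝟙 E₀) →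
      ∀ (e : ProjectiveEmbedding (pad4Anchor E₀).X) (a : complexBetti (projectiveSpace e.n ℂ) 2)
      (w : complexBetti (pad4Anchor E₀).X (2 * 4)),
      IsRationalClass a → a ≠ 0 →
      IsHyperbolicWeilType (pad4Anchor E₀) (pad4Action E₀ ψ₀) 4 (symH d (pad4Action E₀ ψ₀) e a) →
      w ∈ weilClassesOf (pad4Anchor E₀) (pad4Action E₀ ψ₀) 4 d → IsRationalClass w →
      IsOfHodgeType (2 * 4) (pad4Anchor E₀).X (2 * 4) 4 4 w → w ≠ 0 →
      ∃ w' : complexBetti (pad4Anchor E₀).X (2 * 4),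
        w' ∈ weilClassesOf (pad4Anchor E₀) (pad4Action E₀ ψ₀) 4 d ∧ IsRationalClass w' ∧ w' ≠ 0 ∧
        HasSeedOn (lfDesignClass C) 4 (pad4Anchor E₀) (symH d (pad4Action E₀ ψ₀) e a) w') :
    ∀ (C : ChernCharacterBetti) (d : ℕ), 0 < d → HasHyperbolicSeedOn (foClass C) 4 d :=
  hasHyperbolicSeedOn_foClass_of_at (kappaDesign_pad4_of_lfDesign hD) stub_firstOrderLift_pad4_at

end Summit.HodgeConjecture.HodgeConjecture.Cruxes.FirstOrderWeilSeedsEightCP.Birth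

end
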